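import Literature.AnabelianGeometry.SemiGraphs.ArithThm54AtAffWitness
import Literature.AnabelianGeometry.SemiGraphs.ArithThm54iiVerticialMaximalReclosed
import Literature.AnabelianGeometry.SemiGraphs.ArithMaximalCompactClosures
import Literature.AnabelianGeometry.SemiGraphs.ArithBranchTransportOfRepresentation
import Literature.AnabelianGeometry.SemiGraphs.ArithTotalEstrangementLoopGraphBranchTransport
import Literature.AnabelianGeometry.SemiGraphs.ArithTotalEstrangementDoubleLoopBranchTransport
import HarnessLib

/-!
# [SemiAnbd] Thm 5.4 (ii) (and (i), same closer family) — the cone nodes' FACT-binder sites re-read: F-1401 `IsArithAmple aug ⊤` SUPPLIED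
# by the printed surjection `Π^temp_𝔊 ↠ Π_A`; F-1406 `IsTotallyArithEstranged …` at the with-edge closer:
# a THEOREM only without edges, REFUTED at both with-edge Thm-3.7 witnesses of the tree in CAPSTONE v9's own frame

Mochizuki, *Semi-graphs of anabelioids*, Publ. RIMS **42** (2006) 221–322, §5: Def 5.3 (i) p. 65 («arithmetically
ample»: "surjects onto an open subgroup of `Π_A`"), Def 5.3 (ii) p. 65 («totally arithmetically estranged»), Prop 5.2
(iv) p. 64 (the surjection `Π^temp_𝔊 ↠ Π_A`), Thm 5.4 (ii) p. 66, Def 5.1 (i) p. 62 (the arithmetic action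
`ρ_𝔾 : π̂₁(A) → Aut(𝔾)`). [cite: MochizukiSemiAnbd2006, Thm 5.4 (ii), p. 66]

PROOF-ONLY file (cell abc-iut, layer L3, cone rows `SemiAnbd:Thm5.4(ii)` AND — same closer family, L3-lead δ25 (2) —
`SemiAnbd:Thm5.4(i)`: K4 re-close of the nodes' refuted-closure BINDERS as indexed by abc-iut-c312-2's
`CONE-K4-RECLOSE.tsv` v4 gen 7 rows 56–57 / `CONE-FACT-SURGERY.tsv` rows 2725–2727 (F-1401 at (ii)) and 2729–2730 (F-1406
at (ii)) plus the F-1406 site of (i) (`…StatementI_outerAction_piPresentation_charCores_of_chartRepresentation`, the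
first component of the SAME capstone v9 — one binder list for (i), (ii) and their conjunction); seat abc-iut-w6-d099
gen 7, director KEY «CN54ii»; sequel of this lineage's `ArithThm54iiVerticialMaximalReclosed.lean` (p487027, F-1399 at
the edgeless carriers)).  No definition, no instance, no new named fact; every input is consumed BY NAME.

§1 **F-1401 (`htop : IsArithAmple aug ⊤`)** — the binder of abc-iut-f-156's
`ProfiniteSemiGraph.arithMaximalCompactStatementII_ofChart_affWitness`, of this lineage's
`ProfiniteSemiGraph.isArithMaximalCompact_of_isVerticial_ofChart_affWitness` and of abc-iut-f-156's
`arithMaximalCompactStatementII_of_vertGp_eq_top`.  Its instance form `IsArithAmple aug ⊤` ("`Π^temp_𝔊` surjects onto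
an open subgroup of `Π_A`") is SUPPLIED by the CLOSED producer `isArithAmple_top_of_surjective` from print's own datum
"the surjection `Π^temp_𝔊 ↠ Π_A`" (Prop 5.2 (iv)): the three closers are re-stated with `Function.Surjective aug`
in place of `htop` (`…_of_surjective`).  At the cell's genuine carriers `Π^temp_𝔊 := π₁^temp(𝒢) ⋊^out Π_A` the
augmentation `outerSemidirectProductSnd ρ` IS onto, and the `_outerAction` forms WITHOUT `htop` were already in the
tree (f-156 `arithMaximalCompactStatementII_ofChart_affWitness_outerAction` p433949, this lineage
`isArithMaximalCompact_of_isVerticial_ofChart_affWitness_outerAction` p487027, abc-iut-w4-d071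
`arithMaximalCompactStatementII_outerModel_of_edgeless` p442607) — recorded, not re-derived.

§2 **F-1406 (`hest : IsTotallyArithEstranged (decompositionDataOfChart …) (outerSemidirectProductSnd ρ′)`)** — the
binder of CAPSTONE v9 `…StatementII_outerAction_piPresentation_charCores_of_chartRepresentation` /
`…StatementI_outerAction_piPresentation_charCores_of_chartRepresentation` (abc-iut-w4-d089 p488210; nodes (ii) / (i))
and CAPSTONE v8 `…Statement_outerAction_piPresentation_charCores_of_branchTransport` (abc-iut-w4-d029 p449794).  All
three closers carry `[Nonempty 𝒢.graph.Edge]`, so the instance form lives at a WITH-EDGE tempered carrier.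
KERNEL FACTS, by composition of landed theorems:
* (positive, edgeless) at every EDGELESS `𝒢` the instance form is a theorem for every chart / representatives /
  target / augmentation (this lineage's `isTotallyArithEstranged_decompositionDataOfChart_of_isEmpty`, p435455) and
  the nodes' statements `ArithMaximalCompactStatementII` / `ArithMaximalCompactStatementI` hold HYPOTHESIS-FREE at
  the outer model over the Thm-3.7 witness `affWitness p` — packaged here as conjunctions
  `thm54ii_and_hest_ofChart_affWitness_outerAction` (binder and (ii) jointly, every `ρ`, every compact topology),
  `thm54i_and_hest_ofChart_affWitness_outerAction` (binder and (i), every `ρ`, every topology) and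
  `thm54_and_hest_ofChart_affWitness_outerAction` (binder ∧ (i) ∧ (ii) — the shape of capstone v9's conjunction);
* (negative, with edge) at BOTH with-edge Thm-3.7 witnesses of the tree the instance form is REFUTED for EVERY outer
  action `ρ′`, every base action, every choice of representatives, as soon as CAPSTONE v9's OTHER displayed binders
  hold — the Def 5.1 (i) representation datum (`F`, `θ`, `hrep`, `hbase`, `hsurjV`, `hsurjE`, from which v9 PRODUCES
  branch transport by abc-iut-w4-d071's `hBR_of_chartRepresentation`, p460259) and `noSwitchBase`:
  `IwahoriWitness.not_isTotallyArithEstranged_loopGraph_of_chartRepresentation` (over abc-iut-f-177's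
  `…loopGraph_of_branchTransport`, p470380) at `𝓛 = loopGraph p`, and — adding v9's strong-completeness binder `hsc` —
  `IwahoriWitness.not_isTotallyArithEstranged_doubleLoop_of_chartRepresentation_of_finiteIndex_isOpen` (over
  abc-iut-f-177's `…doubleLoop_of_branchTransport_of_finiteIndex_isOpen`, p492697) at `𝒟₁ = doubleLoop p`.
HONEST LABEL.  Hence at the v8/v9 sites F-1406 is NOT re-closable from tree producers today: CAPSTONE v9's binder list
is jointly UNINHABITED at every with-edge Thm-3.7 carrier the tree holds; it is INHABITED only at ABSTRACT decomposition
data with an edge (abc-iut-w6-d064 `exists_isTotallyArithEstranged_affine` p440884; this lineage's `QuadAffineWitness`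
p494027), and a with-edge TEMPERED carrier where it holds is the banked residual «NV-T54-RESIDUAL stage 2a» (L3-lead δ2).
Re-closed-at-OUR-carriers ≠ proved-in-print; refuted-as-typed-at-OUR-witnesses ≠ refuted-in-print; typed ≠ proved;
nothing here bears on [IUTchIII] Cor. 3.12.
-/

noncomputable section

namespace Literature.AnabelianGeometry.SemiGraphs

open CategoryTheory Topology
open Literature.AnabelianGeometry.EtaleTheta

universe u u' w w'

/-! ### §1  F-1401: `IsArithAmple aug ⊤` supplied by the printed surjection `Π^temp_𝔊 ↠ Π_A` (Prop 5.2 (iv)) -/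

section F1401Abstract

variable {Gtp : Type u} [Group Gtp] [TopologicalSpace Gtp]
variable {PA : Type u'} [Group PA] [TopologicalSpace PA]
variable {V : Type w} {B : Type w'}

/-- **F-1401 site `arithMaximalCompactStatementII_of_vertGp_eq_top` re-closed** (abc-iut-f-156's Comment-(4)
configuration: at least one vertex, all vertex groups `= Π^temp_𝔊`, no branches, `Π^temp_𝔊` compact): the binder
`htop : IsArithAmple aug ⊤` is SUPPLIED by `isArithAmple_top_of_surjective` from the printed surjection
`Π^temp_𝔊 ↠ Π_A` of Prop 5.2 (iv); Thm 5.4 (ii) AS TYPED follows with no F-binder left.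
[cite: MochizukiSemiAnbd2006, Thm 5.4 (ii), p. 66] -/
theorem arithMaximalCompactStatementII_of_vertGp_eq_top_of_surjective [CompactSpace Gtp] [Nonempty V] [IsEmpty B]
    (D : DecompositionData Gtp V B) (aug : Gtp →* PA) (hV : ∀ v : V, D.vertGp v = ⊤)
    (haug : Function.Surjective aug) :
    Literature.AnabelianGeometry.SemiGraphs.ArithMaximalCompactStatementII D aug :=
  arithMaximalCompactStatementII_of_vertGp_eq_top D aug hV (isArithAmple_top_of_surjective haug)

end F1401Abstract

namespace ProfiniteSemiGraph

section F1401AffWitness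

variable {p : ℕ} [Fact p.Prime] {c : TemperedPiChart (affWitness p)}
variable {Gtp : Type u} [Group Gtp] [TopologicalSpace Gtp]
variable {PA : Type u'} [Group PA] [TopologicalSpace PA]

/-- **F-1401 site `arithMaximalCompactStatementII_ofChart_affWitness` (abc-iut-f-156) re-closed**: at the produced
decomposition data over the Thm-3.7 witness `affWitness p` (every chart, every compatible representatives `R`, every
compact `Π^temp_𝔊 = Gtp`, every `ι` with normal range), Thm 5.4 (ii) AS TYPED holds for every SURJECTIVE augmentation
`aug : Π^temp_𝔊 ↠ Π_A` (Prop 5.2 (iv)) — the binder `htop` SUPPLIED by `isArithAmple_top_of_surjective`.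
[cite: MochizukiSemiAnbd2006, Thm 5.4 (ii), p. 66] -/
theorem arithMaximalCompactStatementII_ofChart_affWitness_of_surjective [CompactSpace Gtp]
    (R : ChartRepresentatives c) (ι : c.G →* Gtp) (hn : ι.range.Normal) (aug : Gtp →* PA)
    (haug : Function.Surjective aug) :
    Literature.AnabelianGeometry.SemiGraphs.ArithMaximalCompactStatementII (decompositionDataOfChart R ι) aug :=
  arithMaximalCompactStatementII_ofChart_affWitness R ι hn aug (isArithAmple_top_of_surjective haug)

/-- **F-1401 site `isArithMaximalCompact_of_isVerticial_ofChart_affWitness` (this lineage, p487027) re-closed**: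
over `affWitness p`, for every SURJECTIVE augmentation (Prop 5.2 (iv)), every verticial subgroup of the produced
data is arithmetically maximal compact — `htop` SUPPLIED by `isArithAmple_top_of_surjective`.
[cite: MochizukiSemiAnbd2006, Thm 5.4 (ii), p. 66] -/
theorem isArithMaximalCompact_of_isVerticial_ofChart_affWitness_of_surjective [CompactSpace Gtp]
    (R : ChartRepresentatives c) (ι : c.G →* Gtp) (hn : ι.range.Normal) (aug : Gtp →* PA)
    (haug : Function.Surjective aug) {K : Subgroup Gtp} (hK : IsVerticial (decompositionDataOfChart R ι) K) :
    IsArithMaximalCompact aug K :=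
  isArithMaximalCompact_of_isVerticial_ofChart_affWitness R ι hn aug (isArithAmple_top_of_surjective haug) hK

variable (ρ : PA →* TopOut c.G)

/-- **§2, positive half — F-1406's instance form AND the node's statement, jointly, at the edgeless genuine
carrier**: at the outer model `π₁^temp(𝒢) ⋊^out Π_A` over `affWitness p` (EVERY outer action `ρ` of any
topological group `Π_A`, every COMPACT topology on the outer semi-direct product, every compatible `R`), the
produced decomposition data are totally arithmetically estranged (no edge to test — this lineage's
`isTotallyArithEstranged_decompositionDataOfChart_of_isEmpty`) AND Thm 5.4 (ii) AS TYPED holds (abc-iut-f-156's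
`arithMaximalCompactStatementII_ofChart_affWitness_outerAction`, its F-1401 binder supplied by surjectivity of the
projection).  No hypothesis is left.  [edgeless: the estrangement conjunct is vacuous — witnessed ≠ endorsed]
[cite: MochizukiSemiAnbd2006, Thm 5.4 (ii), p. 66] -/
theorem thm54ii_and_hest_ofChart_affWitness_outerAction
    [TopologicalSpace (outerSemidirectProduct ρ)] [CompactSpace (outerSemidirectProduct ρ)]
    (R : ChartRepresentatives c) :
    IsTotallyArithEstranged (decompositionDataOfChart R (toOuterSemidirectProduct ρ)) (outerSemidirectProductSnd ρ) ∧
      Literature.AnabelianGeometry.SemiGraphs.ArithMaximalCompactStatementII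
        (decompositionDataOfChart R (toOuterSemidirectProduct ρ)) (outerSemidirectProductSnd ρ) :=
  haveI := isEmpty_edge_affWitness (p := p)
  ⟨isTotallyArithEstranged_decompositionDataOfChart_of_isEmpty c PA R (toOuterSemidirectProduct ρ)
      (outerSemidirectProductSnd ρ),
    arithMaximalCompactStatementII_ofChart_affWitness_outerAction ρ R⟩

/-- **§2, positive half at the `SemiAnbd:Thm5.4(i)` site** (L3-lead δ25 (2): same closer family): at the outer model
over `affWitness p` (EVERY outer action `ρ`, EVERY topology on the outer semi-direct product, every compatible `R`),
F-1406's instance form (no edge to test) AND Thm 5.4 (i) AS TYPED (abc-iut-f-156's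
`arithMaximalCompactStatementI_ofChart_affWitness_outerAction`) hold jointly, hypothesis-free.
[edgeless: the estrangement conjunct is vacuous — witnessed ≠ endorsed] [cite: MochizukiSemiAnbd2006, Thm 5.4 (i), p. 66] -/
theorem thm54i_and_hest_ofChart_affWitness_outerAction [TopologicalSpace (outerSemidirectProduct ρ)]
    (R : ChartRepresentatives c) :
    IsTotallyArithEstranged (decompositionDataOfChart R (toOuterSemidirectProduct ρ)) (outerSemidirectProductSnd ρ) ∧
      Literature.AnabelianGeometry.SemiGraphs.ArithMaximalCompactStatementI
        (decompositionDataOfChart R (toOuterSemidirectProduct ρ)) (outerSemidirectProductSnd ρ) :=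
  haveI := isEmpty_edge_affWitness (p := p)
  ⟨isTotallyArithEstranged_decompositionDataOfChart_of_isEmpty c PA R (toOuterSemidirectProduct ρ)
      (outerSemidirectProductSnd ρ),
    arithMaximalCompactStatementI_ofChart_affWitness_outerAction ρ R⟩

/-- **§2, positive half in CAPSTONE v9's conjunction shape** (`…Statement_outerAction_piPresentation_charCores_…`
concludes `StatementI ∧ StatementII` under the binder `hest`): at the outer model over `affWitness p` (every `ρ`,
every COMPACT topology, every `R`) the binder's instance form, Thm 5.4 (i) and Thm 5.4 (ii) AS TYPED hold jointly,
hypothesis-free — the edgeless genuine carrier of record (one vertex `B(Aff(ℤ_p))`, no edge; abc-iut-w5-d212/w5-d236).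
[edgeless: the estrangement conjunct is vacuous — witnessed ≠ endorsed] [cite: MochizukiSemiAnbd2006, Thm 5.4 (ii), p. 66] -/
theorem thm54_and_hest_ofChart_affWitness_outerAction
    [TopologicalSpace (outerSemidirectProduct ρ)] [CompactSpace (outerSemidirectProduct ρ)]
    (R : ChartRepresentatives c) :
    IsTotallyArithEstranged (decompositionDataOfChart R (toOuterSemidirectProduct ρ)) (outerSemidirectProductSnd ρ) ∧
      Literature.AnabelianGeometry.SemiGraphs.ArithMaximalCompactStatementI
          (decompositionDataOfChart R (toOuterSemidirectProduct ρ)) (outerSemidirectProductSnd ρ) ∧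
        Literature.AnabelianGeometry.SemiGraphs.ArithMaximalCompactStatementII
          (decompositionDataOfChart R (toOuterSemidirectProduct ρ)) (outerSemidirectProductSnd ρ) :=
  ⟨(thm54i_and_hest_ofChart_affWitness_outerAction ρ R).1, (thm54i_and_hest_ofChart_affWitness_outerAction ρ R).2,
    (thm54ii_and_hest_ofChart_affWitness_outerAction ρ R).2⟩

end F1401AffWitness

end ProfiniteSemiGraph

/-! ### §2, negative half  F-1406 at CAPSTONE v9's with-edge carriers of record: refuted in v9's own frame -/

namespace IwahoriWitness

open ProfiniteSemiGraph

section LoopGraph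

variable (p : ℕ) [Fact p.Prime] (c : TemperedPiChart (loopGraph p)) {PA : Type*} [Group PA]
  [TopologicalSpace PA] (ρ' : PA →* TopOut c.G) (baseAct : PA →* Aut (loopGraph p).graph)

/-- **F-1406 at the Iwahori loop `𝓛 = loopGraph p` in CAPSTONE v9's shape**: for EVERY `Π_A`, EVERY outer action
`ρ′ : Π_A → Out(π₁^temp 𝓛)` and base action, EVERY Def 5.1 (i) representation datum (`F`, `θ`, `hrep`, `hbase`,
`hsurjV`, `hsurjE` — exactly the binders from which CAPSTONE v9 PRODUCES branch transport, abc-iut-w4-d071's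
`hBR_of_chartRepresentation`) with `noSwitchBase`, and EVERY choice `Rc` of §3 representatives (in particular print's
`ChartRepresentatives.ofPresentation …` read by v9), the produced decomposition data of `π₁^temp(𝓛) ⋊^out Π_A` are
NOT totally arithmetically estranged — abc-iut-f-177's `not_isTotallyArithEstranged_loopGraph_of_branchTransport`
composed with `hBR_of_chartRepresentation`.  So v9's binder list minus `hest` REFUTES `hest` at `𝓛` — for the
(i)-closer, the (ii)-closer and their conjunction alike (one binder list).
[refuted-as-typed at OUR witness ≠ refuted in print] [cite: MochizukiSemiAnbd2006, Def 5.3 (ii), p. 65] -/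
theorem not_isTotallyArithEstranged_loopGraph_of_chartRepresentation
    (F : PA → ProfiniteSemiGraph.Hom (loopGraph p) (loopGraph p)) (θ : ∀ a, (F a).ConjugatorFamily)
    (hrep : ∀ a, ∃ (Φ : contMulAut c.G) (φhat : c.G →ₜ* c.G), TopOut.mk c.G Φ = ρ' a ∧
      (∀ t, (Φ : MulAut c.G) t = φhat t) ∧ Nonempty ((F a).chartPullbackWith (θ a) c c ≅ BTemp.res φhat))
    (hbase : ∀ a, (F a).base = (baseAct a).hom)
    (hsurjV : ∀ a v, Function.Surjective ((F a).hV v))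
    (hsurjE : ∀ a e, Function.Surjective ((F a).hE e))
    (noSwitchBase : NoBranchSwitching (loopGraph p).graph.edgeOf
      (fun (a : PA) (b : (loopGraph p).graph.Branch) => (baseAct a).hom.branchMap b))
    (Rc : ChartRepresentatives c) :
    ¬ IsTotallyArithEstranged (decompositionDataOfChart Rc (toOuterSemidirectProduct ρ'))
      (outerSemidirectProductSnd ρ') :=
  not_isTotallyArithEstranged_loopGraph_of_branchTransport p c ρ' baseAct
    (hBR_of_chartRepresentation c ρ' baseAct (loopGraph_thm37Hypotheses p) F θ hrep hbase hsurjV hsurjE)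
    noSwitchBase Rc

end LoopGraph

section DoubleLoop

variable (p : ℕ) [Fact p.Prime] (c : TemperedPiChart (doubleLoop p)) {PA : Type*} [Group PA]
  [TopologicalSpace PA] [IsTopologicalGroup PA] (ρ' : PA →* TopOut c.G) (baseAct : PA →* Aut (doubleLoop p).graph)

/-- **F-1406 at the Iwahori segment `𝒟₁ = doubleLoop p` in CAPSTONE v9's shape**: for EVERY topological group
`Π_A` that is STRONGLY COMPLETE (every finite-index subgroup open — CAPSTONE v9's own binder `hsc`, Def 5.1 (i)(a) /
[IUTchI] Rmk 2.5.3 (vi) (O3)), EVERY outer action `ρ′` and base action, EVERY Def 5.1 (i) representation datum with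
`noSwitchBase`, and EVERY `Rc`, the produced decomposition data of `π₁^temp(𝒟₁) ⋊^out Π_A` are NOT totally
arithmetically estranged — abc-iut-f-177's
`not_isTotallyArithEstranged_doubleLoop_of_branchTransport_of_finiteIndex_isOpen` composed with abc-iut-w4-d071's
`hBR_of_chartRepresentation`.  So v9's binder list minus `hest` REFUTES `hest` at `𝒟₁` as well.
[refuted-as-typed at OUR witness ≠ refuted in print] [cite: MochizukiSemiAnbd2006, Def 5.3 (ii), p. 65] -/
theorem not_isTotallyArithEstranged_doubleLoop_of_chartRepresentation_of_finiteIndex_isOpen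
    (F : PA → ProfiniteSemiGraph.Hom (doubleLoop p) (doubleLoop p)) (θ : ∀ a, (F a).ConjugatorFamily)
    (hrep : ∀ a, ∃ (Φ : contMulAut c.G) (φhat : c.G →ₜ* c.G), TopOut.mk c.G Φ = ρ' a ∧
      (∀ t, (Φ : MulAut c.G) t = φhat t) ∧ Nonempty ((F a).chartPullbackWith (θ a) c c ≅ BTemp.res φhat))
    (hbase : ∀ a, (F a).base = (baseAct a).hom)
    (hsurjV : ∀ a v, Function.Surjective ((F a).hV v))
    (hsurjE : ∀ a e, Function.Surjective ((F a).hE e))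
    (noSwitchBase : NoBranchSwitching (doubleLoop p).graph.edgeOf
      (fun (a : PA) (b : (doubleLoop p).graph.Branch) => (baseAct a).hom.branchMap b))
    (hsc : ∀ H : Subgroup PA, H.FiniteIndex → IsOpen (H : Set PA))
    (Rc : ChartRepresentatives c) :
    ¬ IsTotallyArithEstranged (decompositionDataOfChart Rc (toOuterSemidirectProduct ρ'))
      (outerSemidirectProductSnd ρ') :=
  not_isTotallyArithEstranged_doubleLoop_of_branchTransport_of_finiteIndex_isOpen p c ρ' baseAct
    (hBR_of_chartRepresentation c ρ' baseAct (doubleLoop_thm37Hypotheses p) F θ hrep hbase hsurjV hsurjE)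
    noSwitchBase hsc Rc

end DoubleLoop

end IwahoriWitness

end Literature.AnabelianGeometry.SemiGraphs
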